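import Literature.Geometry.Riemannian.FamilyPartialDerivatives
import Mathlib.Analysis.Calculus.ContDiff.Bounds
import HarnessLib

/-!
# Space derivatives of the deformed slices (Bär–Hanke 2023, §3, (18)–(19) and Prop. 23)

A calculus brick (K5c of the notes) of the proof of the named fact
`Literature.Geometry.Riemannian.BarHanke2023_thm27_umbilicNormalForm`. In a chart the slice at
time `t` of the deformed cylinder (`CylinderNormalFormChart.lean`) is the function of `y`

  `Q(y) = (1 − a t) F(y, t) + a t (1 − (C t² + 2 μ̃(y) χ(t))) F(y, 0) + a t (t − χ t) Ḟ(y, 0)`.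

For the pointwise estimates (`MetricCoord.stepA_pointwise`, `MetricCoord.stepB_pointwise`) one
needs its first two `y`-derivatives compared with those of the reference slice. With the
space-derivative families `F₁ = D_yF`, `F₂ = D²_yF` (`FamilyPartialDerivatives.lean`:
`D_y Ḟ(·,0) = Ḟ₁(·,0)`, `D²_y Ḟ(·,0) = Ḟ₂(·,0)`) this file proves:

* region A (`χ(t) = 0`; `Q = P + θ w`, `P = F(·,t)`, `θ = a t`,
  `w = F(·,0) + tḞ(·,0) − Ct²F(·,0) − F(·,t)`): `D^j Q − D^j P = θ (F_j(·,0) + t Ḟ_j(·,0) − Ct² F_j(·,0) − F_j(·,t))`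
  for `j = 0, 1, 2` (`regionA_sub`, `fderiv_regionA_sub`, `fderiv_fderiv_regionA_sub`) and the
  resulting bounds `‖D^j Q − D^j P‖ ≤ 2b(1+C)t²` from the uniform Taylor bounds
  (`norm_regionA_sub_le` etc.);
* region B (`a t = 1`; `A = F(·,0)`): `D^j Q − D^j A = −Ct² F_j(·,0) − 2χ(t) D^j(μ̃ F(·,0)) + (t − χ t) Ḟ_j(·,0)`
  (`regionB_sub`, `fderiv_regionB_sub`, `fderiv_fderiv_regionB_sub`), with the Leibniz bounds
  `‖D(μ̃F₀)‖ ≤ 2MB`, `‖D²(μ̃F₀)‖ ≤ 4MB` (`norm_fderiv_smul_le`, `norm_fderiv_fderiv_smul_le`).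

Everything is proved; no definitions, no named facts (D-0026).

## References

* C. Bär, B. Hanke, *Boundary conditions for scalar curvature*, arXiv:2012.09127, §3, Prop. 23
  and proof of Prop. 26, (18)–(19). [BarHanke2023]
-/

noncomputable section

set_option maxSynthPendingDepth 3

open Set Filter Function Metric
open scoped Topology ContDiff

namespace Literature.Geometry.Riemannian

variable {V : Type*} [NormedAddCommGroup V] [NormedSpace ℝ V]
  {W : Type*} [NormedAddCommGroup W] [NormedSpace ℝ W]
  {F : V → ℝ → W} {U : Set V}

section Families

variable (hU : IsOpen U) (hF : ContDiffOn ℝ ∞ (fun q : V × ℝ ↦ F q.1 q.2) (U ×ˢ univ))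
  {F₁ : V → ℝ → V →L[ℝ] W}
  (hF₁ : ∀ (y : V) (s : ℝ), F₁ y s =
    (fderiv ℝ (fun q : V × ℝ ↦ F q.1 q.2) (y, s)).comp (ContinuousLinearMap.inl ℝ V ℝ))

include hU hF hF₁

/-- The space-derivative family `F₁` is a `C^∞` family. [folklore] -/
theorem contDiffOn_family₁ : ContDiffOn ℝ ∞ (fun q : V × ℝ ↦ F₁ q.1 q.2) (U ×ˢ univ) :=
  (contDiffOn_familyFDeriv hU hF).congr fun q _ ↦ hF₁ q.1 q.2

/-- `D_y F(·, s)(y) = F₁ y s` as a Fréchet derivative. [folklore] -/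
theorem hasFDerivAt_slice₁ {y : V} (hy : y ∈ U) (s : ℝ) :
    HasFDerivAt (fun y ↦ F y s) (F₁ y s) y := by
  rw [hF₁]; exact hasFDerivAt_slice hU hF hy s

/-- **`D_y Ḟ(·, s)(y) = Ḟ₁(y, s)`** as a Fréchet derivative. [folklore] -/
theorem hasFDerivAt_deriv_slice₁ {y : V} (hy : y ∈ U) (s : ℝ) :
    HasFDerivAt (fun y ↦ deriv (F y) s) (deriv (F₁ y) s) y := by
  -- differentiability: near `y`, `y' ↦ ∂_s F y' s = DΦ(y', s)(0, 1)`
  have hev : (fun y' ↦ deriv (F y') s) =ᶠ[𝓝 y]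
      fun y' ↦ fderiv ℝ (fun q : V × ℝ ↦ F q.1 q.2) (y', s) ((0 : V), (1 : ℝ)) := by
    filter_upwards [hU.mem_nhds hy] with y' hy'
    exact (hasDerivAt_family_of_contDiffOn hU hF hy' s).deriv
  have hΦ₁ : ContDiffOn ℝ ∞ (fderiv ℝ (fun q : V × ℝ ↦ F q.1 q.2)) (U ×ˢ univ) :=
    hF.fderiv_of_isOpen (m := ∞) (hU.prod isOpen_univ) le_rfl
  have hq : ((y, s) : V × ℝ) ∈ U ×ˢ (univ : Set ℝ) := ⟨hy, mem_univ _⟩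
  have hd1 : DifferentiableAt ℝ (fun y' ↦ fderiv ℝ (fun q : V × ℝ ↦ F q.1 q.2) (y', s)) y :=
    ((hΦ₁.differentiableOn (by simp)).differentiableAt ((hU.prod isOpen_univ).mem_nhds hq)).comp y
      ((differentiableAt_id.prodMk (differentiableAt_const s)))
  have hd2 : DifferentiableAt ℝ
      (fun y' ↦ fderiv ℝ (fun q : V × ℝ ↦ F q.1 q.2) (y', s) ((0 : V), (1 : ℝ))) y :=
    hd1.clm_apply (differentiableAt_const _)
  have hd : DifferentiableAt ℝ (fun y' ↦ deriv (F y') s) y := hd2.congr_of_eventuallyEq hev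
  have h := hd.hasFDerivAt
  rw [fderiv_deriv_eq_deriv_familyFDeriv hU hF hy s] at h
  have hfun : (fun σ ↦ (fderiv ℝ (fun q : V × ℝ ↦ F q.1 q.2) (y, σ)).comp
      (ContinuousLinearMap.inl ℝ V ℝ)) = F₁ y := funext fun σ ↦ (hF₁ y σ).symm
  rwa [hfun] at h

/-- **Derivative of the deformed slice.** If on the open set `U`
`Q(y) = α F(y,t) + c F(y,0) + e Ḟ(y,0) + κ H(y)` with constants `α, c, e, κ` and `H` of class
`C^∞` on `U`, then `DQ(y) = α F₁(y,t) + c F₁(y,0) + e Ḟ₁(y,0) + κ DH(y)` for `y ∈ U` (region A: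
`κ = 0`; region B: `α = 0`, `H = μ̃ F(·,0)`). Applied a second time to the families `F₁, F₂` and
`H₁ = DH` it gives the second derivative. [cite: BarHanke2023, §3, Prop. 23 and (18)–(19)] -/
theorem fderiv_combo {Q : V → W} {H : V → W} (hH : ContDiffOn ℝ ∞ H U) {t α c e κ : ℝ}
    (hQ : EqOn Q (fun y ↦ α • F y t + c • F y 0 + e • deriv (F y) 0 + κ • H y) U)
    {y : V} (hy : y ∈ U) :
    fderiv ℝ Q y = α • F₁ y t + c • F₁ y 0 + e • deriv (F₁ y) 0 + κ • fderiv ℝ H y := by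
  have hHd : HasFDerivAt H (fderiv ℝ H y) y :=
    ((hH.differentiableOn (by simp)).differentiableAt (hU.mem_nhds hy)).hasFDerivAt
  have h : HasFDerivAt (fun y ↦ α • F y t + c • F y 0 + e • deriv (F y) 0 + κ • H y)
      (α • F₁ y t + c • F₁ y 0 + e • deriv (F₁ y) 0 + κ • fderiv ℝ H y) y :=
    ((((hasFDerivAt_slice₁ hU hF hF₁ hy t).const_smul α).add
      ((hasFDerivAt_slice₁ hU hF hF₁ hy 0).const_smul c)).add
      ((hasFDerivAt_deriv_slice₁ hU hF hF₁ hy 0).const_smul e)).add (hHd.const_smul κ)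
  have hev : Q =ᶠ[𝓝 y] fun y ↦ α • F y t + c • F y 0 + e • deriv (F y) 0 + κ • H y := by
    filter_upwards [hU.mem_nhds hy] with y' hy'
    exact hQ hy'
  rw [hev.fderiv_eq, h.fderiv]

/-- `EqOn` form of `fderiv_combo` (for iterating). [folklore] -/
theorem eqOn_fderiv_combo {Q : V → W} {H : V → W} (hH : ContDiffOn ℝ ∞ H U) {t α c e κ : ℝ}
    (hQ : EqOn Q (fun y ↦ α • F y t + c • F y 0 + e • deriv (F y) 0 + κ • H y) U) :
    EqOn (fderiv ℝ Q)
      (fun y ↦ α • F₁ y t + c • F₁ y 0 + e • deriv (F₁ y) 0 + κ • fderiv ℝ H y) U :=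
  fun _ hy ↦ fderiv_combo hU hF hF₁ hH hQ hy

/-- The reference slice: `D F(·, s)(y) = F₁ y s`. [folklore] -/
theorem fderiv_slice₁ {y : V} (hy : y ∈ U) (s : ℝ) : fderiv ℝ (fun y ↦ F y s) y = F₁ y s :=
  (hasFDerivAt_slice₁ hU hF hF₁ hy s).fderiv

/-- `EqOn` form of `fderiv_slice₁`. [folklore] -/
theorem eqOn_fderiv_slice₁ (s : ℝ) : EqOn (fderiv ℝ (fun y ↦ F y s)) (fun y ↦ F₁ y s) U :=
  fun _ hy ↦ fderiv_slice₁ hU hF hF₁ hy s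

end Families

/-! ### Leibniz bounds for `μ̃ F(·, 0)` -/

section Leibniz

variable (hU : IsOpen U) {φ : V → ℝ} {g : V → W} (hφ : ContDiffOn ℝ ∞ φ U) (hg : ContDiffOn ℝ ∞ g U)

include hU hφ hg

/-- **`‖D(φ g)(y)‖ ≤ |φ(y)| ‖Dg(y)‖ + ‖Dφ(y)‖ ‖g(y)‖`** on an open set. [folklore] -/
theorem norm_fderiv_smul_le {y : V} (hy : y ∈ U) :
    ‖fderiv ℝ (fun y ↦ φ y • g y) y‖ ≤
      |φ y| * ‖fderiv ℝ g y‖ + ‖fderiv ℝ φ y‖ * ‖g y‖ := by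
  have h := norm_iteratedFDerivWithin_smul_le (n := 1) hφ hg hU.uniqueDiffOn hy
    (WithTop.coe_le_coe.2 le_top)
  rw [iteratedFDerivWithin_of_isOpen 1 hU hy, norm_iteratedFDeriv_one] at h
  refine h.trans (le_of_eq ?_)
  rw [Finset.sum_range_succ, Finset.sum_range_one]
  simp only [Nat.choose_zero_right, Nat.cast_one, one_mul, Nat.sub_zero, Nat.choose_self,
    Nat.reduceSub, iteratedFDerivWithin_of_isOpen _ hU hy, norm_iteratedFDeriv_zero,
    norm_iteratedFDeriv_one, Real.norm_eq_abs]

/-- **`‖D²(φ g)(y)‖ ≤ |φ| ‖D²g‖ + 2 ‖Dφ‖ ‖Dg‖ + ‖D²φ‖ ‖g‖`** on an open set. [folklore] -/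
theorem norm_fderiv_fderiv_smul_le {y : V} (hy : y ∈ U) :
    ‖fderiv ℝ (fderiv ℝ (fun y ↦ φ y • g y)) y‖ ≤
      |φ y| * ‖fderiv ℝ (fderiv ℝ g) y‖ + 2 * (‖fderiv ℝ φ y‖ * ‖fderiv ℝ g y‖) +
        ‖fderiv ℝ (fderiv ℝ φ) y‖ * ‖g y‖ := by
  have h := norm_iteratedFDerivWithin_smul_le (n := 2) hφ hg hU.uniqueDiffOn hy
    (WithTop.coe_le_coe.2 le_top)
  have h2 : ∀ (f : V → W), ‖iteratedFDeriv ℝ 2 f y‖ = ‖fderiv ℝ (fderiv ℝ f) y‖ := fun f ↦ by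
    rw [← norm_iteratedFDeriv_fderiv, norm_iteratedFDeriv_one]
  have h2' : ∀ (f : V → ℝ), ‖iteratedFDeriv ℝ 2 f y‖ = ‖fderiv ℝ (fderiv ℝ f) y‖ := fun f ↦ by
    rw [← norm_iteratedFDeriv_fderiv, norm_iteratedFDeriv_one]
  rw [iteratedFDerivWithin_of_isOpen 2 hU hy, h2] at h
  refine h.trans (le_of_eq ?_)
  rw [Finset.sum_range_succ, Finset.sum_range_succ, Finset.sum_range_one]
  simp only [Nat.choose_zero_right, Nat.cast_one, one_mul, Nat.sub_zero, Nat.choose_self,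
    Nat.reduceSub, iteratedFDerivWithin_of_isOpen _ hU hy, norm_iteratedFDeriv_zero,
    norm_iteratedFDeriv_one, Real.norm_eq_abs, h2, h2', show Nat.choose 2 1 = 2 by rfl,
    Nat.cast_ofNat]
  ring

end Leibniz

end Literature.Geometry.Riemannian

end
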